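import Summits.CriticalPhenomena.Ising3DConformalLimit.Theses.LogPolarProxy
import Summits.CriticalPhenomena.Ising3DConformalLimit.Theses.IsingEuclidUpgrade
import Summits.CriticalPhenomena.Ising3DConformalLimit.Theses.HyperoctahedralRP
import Summits.CriticalPhenomena.Ising3DConformalLimit.Theorems.ArmHyperscalingMergingFloorGlue
import Summits.CriticalPhenomena.Ising3DConformalLimit.Theorems.ExistsScaleCovariantLimit.Negative.DeltaDetermined
import HarnessLib

/-!
# Line `delta-isotherm-newman` for crux stmt-CriticalPhenomena-0636 (`IsingEuclidUpgradeR4NonGaussian`)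
(ALTERNATIVE line of the crux strategist, gen s2, 2026-08-17, bet route LogPolarProxy; the live skeleton
`Lines/isotherm_saturation_lee_yang.lean` is NOT replaced.)

**Idea.** Newman's 1979 non-Gaussianity criterion (Comm. Math. Phys. 66, Corollary 2.6; Ellis 2006,
Theorem V.8.6) says: IF the critical free energy obeys `f(h) − f(0)h ≤ K h^{1+1/δ}` with the HYPERSCALING
value `2 − η = d(δ−1)/(δ+1)` ((2.25)) AND the summed two-point function has the pure-power floor
`G(R) ≥ ε R^{2−η}` ((2.26), "no logarithmic terms"), THEN every limit in law of the normalised block spin is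
non-Gaussian. In the tree's pointwise-limit currency the scaling dimension `Δ` of the limit is available
(`IsScaleCovariant Δ S`, `Δ ∈ [1/2,3/4]` by `delta_mem_Icc_of_witness`, `η = 2Δ − 1`), `1/δ_hs = Δ/(3−Δ)` and
`d + 2 − η = 6 − 2Δ`, and the convergence-in-law hypothesis is replaced by the LANDED Lee–Yang package of the
block law (`ArmHyperscalingMergingFloor.nonGaussian_of_matchedUpperIsotherm`: Lee–Yang deficit ⟹ Binder
floor at the matched field ⟹ `U₄ ≢ 0`, via `gaussianLimitKillsBlockCoupling_proof`). So the crux follows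
from exactly Newman's two hypotheses, typed over existing declarations:

* S1 `stub_deltaHyperscalingIsotherm` — δ-HYPERSCALING UPPER ISOTHERM `m(β_c,h) ≤ A h^{Δ/(3−Δ)}`,
  `0 < h ≤ h₀`: the unproved half of `δ = (d+2−η)/(d−2+η)` (Fisher 1969 / Buckingham–Gunton 1969 /
  Newman 1979 prove `δ ≥`); tight against ABF87 `m ≥ c h^{1/3}` at `Δ = 3/4`
  (tree: `not_isothermGain_above_third`); FALSE for `d ≥ 5` (`δ = 3`), so it carries the `d < 4` input
  `Disproof.lean §D` demands. ONE-point, monotone in `h` (GHS), lattice-side.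
* S2 `stub_blockSecondMomentLower` — BLOCK SECOND-MOMENT FLOOR `Σ_L = ⟨M_L²⟩_{β_c} ≥ c L^{6−2Δ}`
  eventually: the slowly varying factor `ℓ` in `ρ(δ) = δ^Δ ℓ(δ)` does not tend to `0` (no multiplicative
  logarithms below `d_c = 4`). TWO-point, lattice-side (IR bound / random currents / regular variation).

Composition (kernel-checked below, no sorry outside the stubs): with `θ = Δ/(3−Δ)`, `e = 6 − 2Δ`,
`e(1+θ)/2 = 3`, at the matched field `h_L = C/√Σ_L ≤ h₀` one has
`(2L+1)³ m(β_c,h_L) ≤ 27 A L³ C^θ Σ_L^{−θ/2} ≤ ½ β_c C √Σ_L` as soon as `C^{1−θ} ≥ 54A/(β_c c^{(1+θ)/2})`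
— this is S1 `stub_matchedUpperIsotherm` of the live line, whence the crux by the landed payer.
Neither stub alone gives the crux (¬crux ∧ S1 is the log world `ℓ → 0`; S2 alone is consistent with a
pure-power generalised free field), and neither is the crux reworded (both are statements about ONE
resp. TWO-point lattice functions, the crux is about `U₄` of the limit).
-/

namespace Summit.CriticalPhenomena.Ising3DConformalLimit.Cruxes.IsingEuclidUpgradeR4NonGaussian.DeltaIsothermNewman

open Literature.Probability.LatticeModels Filter Set Finset
open scoped Topology BigOperators

/-! ### Registered stubs -/

/-- **S1 (load-bearing, XL): δ-hyperscaling upper critical isotherm.** Under the crux hypotheses plus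
scale covariance with dimension `Δ` (automatic after normalisation), the infinite-volume critical
magnetisation obeys `m(β_c,h) ≤ A h^{Δ/(3−Δ)}` for `0 < h ≤ h₀` — Newman 1979 (2.25) / Ellis (5.48) with the
hyperscaling `δ = (3−Δ)/Δ`. [cite: Newman1979, Corollary 2.6] -/
theorem stub_deltaHyperscalingIsotherm :
    ∀ (ρ : ℝ → ℝ) (Δ : ℝ) (S : Literature.Probability.LatticeModels.CorrFamily 3), (∀ δ ∈ Set.Ioc (0:ℝ) 1, 0 < ρ δ) → Literature.Probability.LatticeModels.HasPointwiseScalingLimit (Literature.Probability.LatticeModels.criticalCorr 3) ρ S → Literature.Probability.LatticeModels.IsNondegenerateTwoPoint S → Literature.Probability.LatticeModels.IsScaleCovariant Δ S → ∃ A h₀ : ℝ, 0 < h₀ ∧ ∀ h : ℝ, 0 < h → h ≤ h₀ → Literature.Probability.LatticeModels.magnetizationInField 3 (Literature.Probability.LatticeModels.criticalBeta 3) h ≤ A * h ^ (Δ / (3 - Δ)) := by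
  sorry

/-- **S2 (L–XL): block second-moment floor, no vanishing slowly varying factor.** Under the same
hypotheses `Σ_L = ⟨M_L²⟩_{β_c,Λ=ℤ³}` restricted to the box `Λ_L` satisfies `Σ_L ≥ c L^{6−2Δ}` eventually —
Newman 1979 (2.26) / Ellis (5.47) in block form. [cite: Newman1979, Corollary 2.6] -/
theorem stub_blockSecondMomentLower :
    ∀ (ρ : ℝ → ℝ) (Δ : ℝ) (S : Literature.Probability.LatticeModels.CorrFamily 3), (∀ δ ∈ Set.Ioc (0:ℝ) 1, 0 < ρ δ) → Literature.Probability.LatticeModels.HasPointwiseScalingLimit (Literature.Probability.LatticeModels.criticalCorr 3) ρ S → Literature.Probability.LatticeModels.IsNondegenerateTwoPoint S → Literature.Probability.LatticeModels.IsScaleCovariant Δ S → ∃ c : ℝ, 0 < c ∧ ∀ᶠ L : ℕ in Filter.atTop, c * (L : ℝ) ^ (6 - 2 * Δ) ≤ Literature.Probability.LatticeModels.plusExpect 3 (Literature.Probability.LatticeModels.criticalBeta 3) 0 (fun σ => (∑ x ∈ Literature.Probability.LatticeModels.box 3 L, Literature.Probability.LatticeModels.spinAt x σ) ^ 2) :=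 by
  sorry

/-! ### The scalar core: at the matched field the isotherm bound beats half the linear response -/

/-- Scalar core of the matched-isotherm estimate. With `θ ∈ (0,1)`, `e·(1+θ)/2 = 3`, `Σ ≥ c L^e`,
`C^{1−θ} ≥ 54A/(β c^{(1+θ)/2})` and `m ≤ A (C/√Σ)^θ`: `(2L+1)³ m ≤ ½ β C √Σ`. [folklore] -/
theorem core_estimate {β A C c θ e Sg Lr m : ℝ} (hβ : 0 < β) (hA : 0 < A) (hC : 0 < C) (hc : 0 < c)
    (hθ0 : 0 < θ) (hθ1 : θ < 1) (he : e * ((1 + θ) / 2) = 3) (hSg : 0 < Sg) (hL1 : 1 ≤ Lr)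
    (hKC : 54 * A / (β * c ^ ((1 + θ) / 2)) ≤ C ^ (1 - θ))
    (hlow : c * Lr ^ e ≤ Sg)
    (hm : m ≤ A * (C / Real.sqrt Sg) ^ θ) :
    (2 * Lr + 1) ^ 3 * m ≤ β * C / 2 * Real.sqrt Sg := by
  have hL0 : 0 < Lr := lt_of_lt_of_le one_pos hL1
  set s := Real.sqrt Sg with hs_def
  have hs : 0 < s := Real.sqrt_pos.2 hSg
  set p := (1 + θ) / 2 with hp_def
  have hp0 : 0 < p := by rw [hp_def]; linarith
  have hcp : 0 < c ^ p := Real.rpow_pos_of_pos hc p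
  -- (2L+1)^3 ≤ 27 L^3
  have hcube : (2 * Lr + 1) ^ 3 ≤ 27 * Lr ^ 3 := by
    have : (2 * Lr + 1) ^ 3 ≤ (3 * Lr) ^ 3 :=
      pow_le_pow_left₀ (by linarith) (by linarith) 3
    linarith [this, show (3 * Lr) ^ 3 = 27 * Lr ^ 3 by ring]
  -- the isotherm bound at the matched field
  have hrhs_nonneg : 0 ≤ A * (C / s) ^ θ := by positivity
  have step1 : (2 * Lr + 1) ^ 3 * m ≤ 27 * Lr ^ 3 * (A * (C / s) ^ θ) :=
    calc (2 * Lr + 1) ^ 3 * m ≤ (2 * Lr + 1) ^ 3 * (A * (C / s) ^ θ) :=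
          mul_le_mul_of_nonneg_left hm (by positivity)
      _ ≤ 27 * Lr ^ 3 * (A * (C / s) ^ θ) := mul_le_mul_of_nonneg_right hcube hrhs_nonneg
  -- s^{1+θ} ≥ c^p L^3
  have hs_rpow : s = Sg ^ (1 / 2 : ℝ) := by rw [hs_def, Real.sqrt_eq_rpow]
  have hspow : c ^ p * Lr ^ (3 : ℕ) ≤ s ^ (1 + θ) := by
    have h1 : s ^ (1 + θ) = Sg ^ p := by
      rw [hs_rpow, ← Real.rpow_mul hSg.le, hp_def]; ring_nf
    have h2 : (c * Lr ^ e) ^ p ≤ Sg ^ p :=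
      Real.rpow_le_rpow (by positivity) hlow hp0.le
    have h3 : (c * Lr ^ e) ^ p = c ^ p * Lr ^ (3 : ℕ) := by
      rw [Real.mul_rpow hc.le (Real.rpow_nonneg hL0.le e), ← Real.rpow_mul hL0.le, he]
      norm_cast
    rw [h1, ← h3]; exact h2
  -- C = C^θ · C^{1-θ} and the choice of C
  have hCsplit : C ^ θ * C ^ (1 - θ) = C := by
    rw [← Real.rpow_add hC]; norm_num
  have hCθ : 0 < C ^ θ := Real.rpow_pos_of_pos hC θ
  have hchoice : 54 * A * C ^ θ ≤ β * c ^ p * C := by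
    have h1 : 54 * A ≤ β * c ^ p * C ^ (1 - θ) := by
      have := hKC
      rw [div_le_iff₀ (by positivity)] at this
      linarith [this]
    calc 54 * A * C ^ θ ≤ β * c ^ p * C ^ (1 - θ) * C ^ θ :=
          mul_le_mul_of_nonneg_right h1 hCθ.le
      _ = β * c ^ p * C := by rw [mul_assoc, mul_comm (C ^ (1 - θ)), hCsplit]
  -- assemble: 27 L^3 A (C/s)^θ ≤ β C/2 · s
  have hdiv : (C / s) ^ θ = C ^ θ / s ^ θ := Real.div_rpow hC.le hs.le θ
  have hsθ : 0 < s ^ θ := Real.rpow_pos_of_pos hs θ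
  have hs1θ : s ^ (1 + θ) = s * s ^ θ := by
    rw [Real.rpow_add hs, Real.rpow_one]
  have step2 : 27 * Lr ^ 3 * (A * (C / s) ^ θ) ≤ β * C / 2 * s := by
    rw [hdiv, show 27 * Lr ^ 3 * (A * (C ^ θ / s ^ θ)) = (27 * Lr ^ 3 * A * C ^ θ) / s ^ θ by ring,
      div_le_iff₀ hsθ]
    have hL3 : 0 ≤ Lr ^ 3 := by positivity
    calc 27 * Lr ^ 3 * A * C ^ θ = (Lr ^ 3) * (54 * A * C ^ θ) / 2 := by ring
      _ ≤ (Lr ^ 3) * (β * c ^ p * C) / 2 := by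
          have := mul_le_mul_of_nonneg_left hchoice hL3
          linarith
      _ = β * C / 2 * (c ^ p * Lr ^ (3 : ℕ)) := by ring
      _ ≤ β * C / 2 * s ^ (1 + θ) :=
          mul_le_mul_of_nonneg_left hspow (by positivity)
      _ = β * C / 2 * s * s ^ θ := by rw [hs1θ]; ring
  exact step1.trans step2

/-! ### S1 of the live line `isotherm-saturation-lee-yang` from the two stubs -/

/-- **S1 `stub_matchedUpperIsotherm` of line `isotherm-saturation-lee-yang` from Newman's two hypotheses**
(child 1 = the δ-hyperscaling upper isotherm `m(β_c,h) ≤ A h^{Δ/(3−Δ)}`; child 2 = the block second-moment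
floor `Σ_L ≥ c L^{6−2Δ}`): at the matched field `h_L = C/√Σ_L` one gets `(2L+1)³ m(β_c,h_L) ≤ ½ β_c C √Σ_L`
eventually, for `C` large. [cite: Newman1979, Corollary 2.6] -/
theorem matchedUpperIsotherm_of_subs
    (h1 : ∀ (ρ : ℝ → ℝ) (Δ : ℝ) (S : Literature.Probability.LatticeModels.CorrFamily 3), (∀ δ ∈ Set.Ioc (0:ℝ) 1, 0 < ρ δ) → Literature.Probability.LatticeModels.HasPointwiseScalingLimit (Literature.Probability.LatticeModels.criticalCorr 3) ρ S → Literature.Probability.LatticeModels.IsNondegenerateTwoPoint S → Literature.Probability.LatticeModels.IsScaleCovariant Δ S → ∃ A h₀ : ℝ, 0 < h₀ ∧ ∀ h : ℝ, 0 < h → h ≤ h₀ → Literature.Probability.LatticeModels.magnetizationInField 3 (Literature.Probability.LatticeModels.criticalBeta 3) h ≤ A * h ^ (Δ / (3 - Δ)))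
    (h2 : ∀ (ρ : ℝ → ℝ) (Δ : ℝ) (S : Literature.Probability.LatticeModels.CorrFamily 3), (∀ δ ∈ Set.Ioc (0:ℝ) 1, 0 < ρ δ) → Literature.Probability.LatticeModels.HasPointwiseScalingLimit (Literature.Probability.LatticeModels.criticalCorr 3) ρ S → Literature.Probability.LatticeModels.IsNondegenerateTwoPoint S → Literature.Probability.LatticeModels.IsScaleCovariant Δ S → ∃ c : ℝ, 0 < c ∧ ∀ᶠ L : ℕ in Filter.atTop, c * (L : ℝ) ^ (6 - 2 * Δ) ≤ Literature.Probability.LatticeModels.plusExpect 3 (Literature.Probability.LatticeModels.criticalBeta 3) 0 (fun σ => (∑ x ∈ Literature.Probability.LatticeModels.box 3 L, Literature.Probability.LatticeModels.spinAt x σ) ^ 2)) :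
    ∀ (ρ : ℝ → ℝ) (Δ : ℝ) (S : CorrFamily 3), (∀ δ ∈ Set.Ioc (0:ℝ) 1, 0 < ρ δ) →
      HasPointwiseScalingLimit (criticalCorr 3) ρ S → IsNondegenerateTwoPoint S →
      IsScaleCovariant Δ S →
      ∃ C : ℝ, 0 < C ∧ ∀ᶠ L : ℕ in atTop,
        (2 * (L : ℝ) + 1) ^ 3 * magnetizationInField 3 (criticalBeta 3)
            (C / Real.sqrt (plusExpect 3 (criticalBeta 3) 0 (fun σ => (∑ x ∈ box 3 L, spinAt x σ) ^ 2))) ≤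
          criticalBeta 3 * C / 2 *
            Real.sqrt (plusExpect 3 (criticalBeta 3) 0 (fun σ => (∑ x ∈ box 3 L, spinAt x σ) ^ 2)) := by
  intro ρ Δ S hρ hlim hnd hsc
  obtain ⟨hΔlo, hΔhi⟩ :=
    ExistsScaleCovariantLimitNegative.delta_mem_Icc_of_witness hρ hlim hnd hsc
  obtain ⟨A₀, h₀, hh₀, hiso⟩ := h1 ρ Δ S hρ hlim hnd hsc
  obtain ⟨c, hc, hlow⟩ := h2 ρ Δ S hρ hlim hnd hsc
  have hβ : 0 < criticalBeta 3 := criticalBeta_pos_holds (d := 3) (by norm_num)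
  -- exponents
  set θ : ℝ := Δ / (3 - Δ) with hθ_def
  have h3Δ : 0 < 3 - Δ := by linarith
  have hθ0 : 0 < θ := by rw [hθ_def]; exact div_pos (by linarith) h3Δ
  have hθ1 : θ < 1 := by rw [hθ_def, div_lt_one h3Δ]; linarith
  set e : ℝ := 6 - 2 * Δ with he_def
  have he0 : 0 < e := by rw [he_def]; linarith
  have he : e * ((1 + θ) / 2) = 3 := by
    rw [he_def, hθ_def]; field_simp; ring
  -- a positive amplitude
  set A : ℝ := max A₀ 1 with hA_def
  have hA : 0 < A := lt_of_lt_of_le one_pos (le_max_right _ _)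
  have hiso' : ∀ h : ℝ, 0 < h → h ≤ h₀ →
      magnetizationInField 3 (criticalBeta 3) h ≤ A * h ^ θ := fun h hh hhh =>
    (hiso h hh hhh).trans (mul_le_mul_of_nonneg_right (le_max_left _ _) (Real.rpow_nonneg hh.le _))
  -- the choice of C
  set p : ℝ := (1 + θ) / 2 with hp_def
  set K : ℝ := 54 * A / (criticalBeta 3 * c ^ p) with hK_def
  have hK : 0 < K := by rw [hK_def]; have := Real.rpow_pos_of_pos hc p; positivity
  set C : ℝ := max 1 (K ^ (1 / (1 - θ))) with hC_def
  have hC1 : 1 ≤ C := le_max_left _ _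
  have hC : 0 < C := lt_of_lt_of_le one_pos hC1
  have hKC : K ≤ C ^ (1 - θ) := by
    have h1θ : 0 < 1 - θ := by linarith
    have hle : K ^ (1 / (1 - θ)) ≤ C := le_max_right _ _
    have := Real.rpow_le_rpow (Real.rpow_nonneg hK.le _) hle h1θ.le
    rwa [← Real.rpow_mul hK.le, one_div_mul_cancel h1θ.ne', Real.rpow_one] at this
  refine ⟨C, hC, ?_⟩
  -- eventual validity: L ≥ 1, the second-moment floor, and h_L ≤ h₀
  have hev1 : ∀ᶠ L : ℕ in atTop, (1 : ℝ) ≤ L :=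
    (Filter.eventually_ge_atTop 1).mono fun L hL => by exact_mod_cast hL
  have hev3 : ∀ᶠ L : ℕ in atTop, (C / h₀) ^ 2 ≤ c * (L : ℝ) ^ e := by
    have ht : Tendsto (fun L : ℕ => c * (L : ℝ) ^ e) atTop atTop :=
      Tendsto.const_mul_atTop hc ((tendsto_rpow_atTop he0).comp tendsto_natCast_atTop_atTop)
    exact ht.eventually_ge_atTop _
  filter_upwards [hev1, hlow, hev3] with L hL1 hlowL h3L
  set Sg := plusExpect 3 (criticalBeta 3) 0 (fun σ => (∑ x ∈ box 3 L, spinAt x σ) ^ 2) with hSg_def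
  have hL0 : (0 : ℝ) < L := lt_of_lt_of_le one_pos hL1
  have hSg : 0 < Sg := lt_of_lt_of_le (by positivity) hlowL
  have hs : 0 < Real.sqrt Sg := Real.sqrt_pos.2 hSg
  -- the matched field is admissible
  have hh : 0 < C / Real.sqrt Sg := div_pos hC hs
  have hhh : C / Real.sqrt Sg ≤ h₀ := by
    rw [div_le_iff₀ hs]
    have h2 : (C / h₀) ^ 2 ≤ Sg := h3L.trans hlowL
    have h3 : C / h₀ ≤ Real.sqrt Sg := by
      rw [← Real.sqrt_sq (div_pos hC hh₀).le]
      exact Real.sqrt_le_sqrt h2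
    rw [div_le_iff₀ hh₀] at h3
    linarith [h3, mul_comm h₀ (Real.sqrt Sg)]
  have hm := hiso' _ hh hhh
  have hKC' : 54 * A / (criticalBeta 3 * c ^ ((1 + θ) / 2)) ≤ C ^ (1 - θ) := by rw [← hp_def]; exact hKC
  exact core_estimate hβ hA hC hc hθ0 hθ1 he hSg hL1 hKC' hlowL hm

/-! ### Composition: the crux by name -/

/-- **COMPOSITION.** S1 and S2 give the crux `IsingEuclidUpgradeR4NonGaussian` — the LogPolarProxy decl
(bet route of this strategist seat) of item stmt-CriticalPhenomena-0636, by name. [cite: Newman1979, Corollary 2.6] -/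
theorem IsingEuclidUpgradeR4NonGaussian_of :
    (∀ (ρ : ℝ → ℝ) (Δ : ℝ) (S : Literature.Probability.LatticeModels.CorrFamily 3), (∀ δ ∈ Set.Ioc (0:ℝ) 1, 0 < ρ δ) → Literature.Probability.LatticeModels.HasPointwiseScalingLimit (Literature.Probability.LatticeModels.criticalCorr 3) ρ S → Literature.Probability.LatticeModels.IsNondegenerateTwoPoint S → Literature.Probability.LatticeModels.IsScaleCovariant Δ S → ∃ A h₀ : ℝ, 0 < h₀ ∧ ∀ h : ℝ, 0 < h → h ≤ h₀ → Literature.Probability.LatticeModels.magnetizationInField 3 (Literature.Probability.LatticeModels.criticalBeta 3) h ≤ A * h ^ (Δ / (3 - Δ))) →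
    (∀ (ρ : ℝ → ℝ) (Δ : ℝ) (S : Literature.Probability.LatticeModels.CorrFamily 3), (∀ δ ∈ Set.Ioc (0:ℝ) 1, 0 < ρ δ) → Literature.Probability.LatticeModels.HasPointwiseScalingLimit (Literature.Probability.LatticeModels.criticalCorr 3) ρ S → Literature.Probability.LatticeModels.IsNondegenerateTwoPoint S → Literature.Probability.LatticeModels.IsScaleCovariant Δ S → ∃ c : ℝ, 0 < c ∧ ∀ᶠ L : ℕ in Filter.atTop, c * (L : ℝ) ^ (6 - 2 * Δ) ≤ Literature.Probability.LatticeModels.plusExpect 3 (Literature.Probability.LatticeModels.criticalBeta 3) 0 (fun σ => (∑ x ∈ Literature.Probability.LatticeModels.box 3 L, Literature.Probability.LatticeModels.spinAt x σ) ^ 2)) →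
    Summit.CriticalPhenomena.Ising3DConformalLimit.Theses.LogPolarProxy.IsingEuclidUpgradeR4NonGaussian :=
  fun h1 h2 => ArmHyperscalingMergingFloor.nonGaussian_of_matchedUpperIsotherm (matchedUpperIsotherm_of_subs h1 h2)

/-- **COMPOSITION** for the HyperoctahedralRP copy (primary route of the crux chain). -/
theorem IsingEuclidUpgradeR4NonGaussian_of_hyperoctahedralRP :
    (∀ (ρ : ℝ → ℝ) (Δ : ℝ) (S : Literature.Probability.LatticeModels.CorrFamily 3), (∀ δ ∈ Set.Ioc (0:ℝ) 1, 0 < ρ δ) → Literature.Probability.LatticeModels.HasPointwiseScalingLimit (Literature.Probability.LatticeModels.criticalCorr 3) ρ S → Literature.Probability.LatticeModels.IsNondegenerateTwoPoint S → Literature.Probability.LatticeModels.IsScaleCovariant Δ S → ∃ A h₀ : ℝ, 0 < h₀ ∧ ∀ h : ℝ, 0 < h → h ≤ h₀ → Literature.Probability.LatticeModels.magnetizationInField 3 (Literature.Probability.LatticeModels.criticalBeta 3) h ≤ A * h ^ (Δ / (3 - Δ))) →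
    (∀ (ρ : ℝ → ℝ) (Δ : ℝ) (S : Literature.Probability.LatticeModels.CorrFamily 3), (∀ δ ∈ Set.Ioc (0:ℝ) 1, 0 < ρ δ) → Literature.Probability.LatticeModels.HasPointwiseScalingLimit (Literature.Probability.LatticeModels.criticalCorr 3) ρ S → Literature.Probability.LatticeModels.IsNondegenerateTwoPoint S → Literature.Probability.LatticeModels.IsScaleCovariant Δ S → ∃ c : ℝ, 0 < c ∧ ∀ᶠ L : ℕ in Filter.atTop, c * (L : ℝ) ^ (6 - 2 * Δ) ≤ Literature.Probability.LatticeModels.plusExpect 3 (Literature.Probability.LatticeModels.criticalBeta 3) 0 (fun σ => (∑ x ∈ Literature.Probability.LatticeModels.box 3 L, Literature.Probability.LatticeModels.spinAt x σ) ^ 2)) →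
    Summit.CriticalPhenomena.Ising3DConformalLimit.Theses.HyperoctahedralRP.IsingEuclidUpgradeR4NonGaussian :=
  fun h1 h2 => ArmHyperscalingMergingFloor.nonGaussian_of_matchedUpperIsotherm (matchedUpperIsotherm_of_subs h1 h2)

/-- **The crux from the registered stubs**, in the primary `IsingEuclidUpgrade` spelling of the shared decl
(the spelling the stub registry keys on; no hypotheses other than the two declared stubs). -/
theorem IsingEuclidUpgradeR4NonGaussian_of_stubs :
    Summit.CriticalPhenomena.Ising3DConformalLimit.Theses.IsingEuclidUpgrade.IsingEuclidUpgradeR4NonGaussian :=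
  ArmHyperscalingMergingFloor.nonGaussian_of_matchedUpperIsotherm
    (matchedUpperIsotherm_of_subs stub_deltaHyperscalingIsotherm stub_blockSecondMomentLower)

/-- The crux from the registered stubs, LogPolarProxy spelling (bet route of this seat). -/
theorem IsingEuclidUpgradeR4NonGaussian_of_stubs_logPolarProxy :
    Summit.CriticalPhenomena.Ising3DConformalLimit.Theses.LogPolarProxy.IsingEuclidUpgradeR4NonGaussian :=
  IsingEuclidUpgradeR4NonGaussian_of stub_deltaHyperscalingIsotherm stub_blockSecondMomentLower

/-- The crux from the registered stubs, HyperoctahedralRP spelling (primary route of the crux chain). -/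
theorem IsingEuclidUpgradeR4NonGaussian_of_stubs_hyperoctahedralRP :
    Summit.CriticalPhenomena.Ising3DConformalLimit.Theses.HyperoctahedralRP.IsingEuclidUpgradeR4NonGaussian :=
  IsingEuclidUpgradeR4NonGaussian_of_hyperoctahedralRP stub_deltaHyperscalingIsotherm stub_blockSecondMomentLower

end Summit.CriticalPhenomena.Ising3DConformalLimit.Cruxes.IsingEuclidUpgradeR4NonGaussian.DeltaIsothermNewman
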